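import Summits.NavierStokesRegularity.FluidComputer.ClayBlowupConcentration
import Mathlib.Order.Lattice.Nat
import HarnessLib

/-!
# The singular slice of a Clay blow-up is SMALL: packing bound `N(r) · r² → 0` and finite `2r`-nets

Cell `ns-blowup`, seat `ns-blowup-ecbridge-2` (g6; the E–C endpoint theory seat). LABEL: E–C typing
(KERNEL — no named fact). WHAT THIS IS NOT: not Navier–Stokes evidence — a necessary condition on the
TYPE `ClayBlowup ν` (no inhabitant is claimed anywhere). Companion memo:
`run/shared/lean/pub/ns-blowup/ecbridge2/ECBRIDGE-2-MEMO-5.md` §2.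

## Content (Scheffer / Caffarelli–Kohn–Nirenberg's covering argument at the FIRST blow-up time, with force)

CKN concentration (`ClayBlowup.ckn_concentration`) says that every singular point `x₀` of the final
slice carries `ε³ r²` of the functional `∫∫_{Q_r(T,x₀)} (|u|³ + |p_N|^{3/2})` at every scale `r ≤ r₁`.
Half of that is carried by the INTEGRABLE majorant
`H = |u|³ + 2|p̃[u]|^{3/2} + 2|Δ⁻¹∇·f|²` (`§2`, the force-potential part costing only `2|B₁| r⁵`),
whose mass in the strip `(T - ρ, T) × ℝ³` tends to `0` with `ρ` (`§1`, continuity from above of a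
finite measure). Since the backward cylinders at `2r`-separated points are disjoint:

* `ClayBlowup.card_separated_singular_le` — **packing bound**: for `0 < r ≤ r₂`, any finite
  `2r`-separated set `P` of singular points has `#P · ε³r²/2 ≤ m(r) := ∫∫_{(T-r²,T)×ℝ³} H`; and
  `m(r) → 0` (`tendsto_stripMass`), so `#P · r² → 0` uniformly — no `2`-dimensional family of
  singular points (CKN 1982 §6 / Scheffer, at the top slice);
* `ClayBlowup.exists_finite_net_singularSlice` — for `0 < r ≤ r₂` a finite set `P` of singular points,
  `2r`-separated, with the whole singular slice inside `⋃_{x ∈ P} B̄(x, 2r)` and the packing bound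
  (a maximal separated subset, `Nat.sSup_mem`). Consumed by `ClayBlowupSingularSliceNull.lean`
  (Lebesgue measure zero and `ℋ²`-measure zero of the singular slice).

References: L. Caffarelli, R. Kohn, L. Nirenberg, CPAM 35 (1982), §6, Prop. 1 / Thm. B
[cite: CaffarelliKohnNirenberg1982, §6]; V. Scheffer, Comm. Math. Phys. 55 (1977) (Hausdorff measure
of the singular set) [cite: CaffarelliKohnNirenberg1982, §1]; J. C. Robinson, J. L. Rodrigo, W. Sadowski,
CUP 2016, Thm. 16.2 [cite: RobinsonRodrigoSadowski2016, Thm. 16.2].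
-/

noncomputable section

namespace Summit.NavierStokesRegularity.FluidComputer

open Set MeasureTheory Filter Topology Function TopologicalSpace Metric
open scoped ENNReal ContDiff NNReal
open Literature.Analysis.FluidPDE
open Summit.NavierStokesRegularity.NavierStokesRegularity
open Summit.NavierStokesRegularity.FluidComputer.PalasekTowerClayBridge

namespace ClayBlowup

variable {ν : ℝ} (X : ClayBlowup ν)

/-! ## §1 The strip mass of the majorant tends to zero -/

/-- **The mass of the CKN majorant in the strip `(T - ρₙ, T) × ℝ³` tends to `0`** along any antitone
sequence `ρₙ → ` (anything): continuity from above of the finite measure `H · vol` on the slab, the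
strips decreasing to a set of times `≥ T`, which the slab does not meet (`ν > 0`). Stated for an
arbitrary antitone sequence of positive widths `ρ`. [folklore] -/
theorem tendsto_stripMass (hν : 0 < ν) {ρ : ℕ → ℝ} (hρ : Antitone ρ) (hρ0 : Tendsto ρ atTop (𝓝 0)) :
    Tendsto (fun n => ∫⁻ z in (Ioo 0 X.T ×ˢ (univ : Set (EuclideanSpace ℝ (Fin 3)))) ∩
        {z : ℝ × EuclideanSpace ℝ (Fin 3) | X.T - ρ n < z.1},
      (‖X.u z.1 z.2‖ₑ ^ (3 : ℕ) + 2 * ‖normalisedPressure (X.u z.1) z.2‖ₑ ^ (3 / 2 : ℝ) +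
        2 * (1 : ℝ≥0∞)⁻¹ ^ (1 / 2 : ℝ) * ‖forcePotential (X.f z.1) z.2‖ₑ ^ 2)) atTop (𝓝 0) := by
  set S : Set (ℝ × EuclideanSpace ℝ (Fin 3)) := Ioo 0 X.T ×ˢ univ with hS
  set H : ℝ × EuclideanSpace ℝ (Fin 3) → ℝ≥0∞ := fun z =>
    ‖X.u z.1 z.2‖ₑ ^ (3 : ℕ) + 2 * ‖normalisedPressure (X.u z.1) z.2‖ₑ ^ (3 / 2 : ℝ) +
      2 * (1 : ℝ≥0∞)⁻¹ ^ (1 / 2 : ℝ) * ‖forcePotential (X.f z.1) z.2‖ₑ ^ 2 with hH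
  have hfin : ∫⁻ z in S, H z < ⊤ := X.lintegral_slab_majorant_lt_top hν one_ne_zero
  set μ : Measure (ℝ × EuclideanSpace ℝ (Fin 3)) := (volume.restrict S).withDensity H with hμ
  set s : ℕ → Set (ℝ × EuclideanSpace ℝ (Fin 3)) := fun n => {z | X.T - ρ n < z.1} with hs
  have hsm : ∀ n, MeasurableSet (s n) := fun n =>
    (isOpen_lt continuous_const continuous_fst).measurableSet
  have hanti : Antitone s := fun m n hmn z hz => by
    simp only [hs, mem_setOf_eq] at hz ⊢
    linarith [hρ hmn]
  have hμs : ∀ n, μ (s n) = ∫⁻ z in S ∩ s n, H z := fun n => by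
    rw [hμ, withDensity_apply _ (hsm n), Measure.restrict_restrict (hsm n), inter_comm]
  have hfin0 : ∃ i, μ (s i) ≠ ⊤ :=
    ⟨0, by rw [hμs]; exact ((lintegral_mono_set inter_subset_left).trans_lt hfin).ne⟩
  have hlim := tendsto_measure_iInter_atTop (μ := μ) (fun n => (hsm n).nullMeasurableSet)
    hanti hfin0
  -- the intersection has no mass: its times are `≥ T`, off the slab
  have hzero : μ (⋂ n, s n) = 0 := by
    have hI : MeasurableSet (⋂ n, s n) := MeasurableSet.iInter hsm
    rw [hμ, withDensity_apply _ hI, Measure.restrict_restrict hI]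
    have hempty : (⋂ n, s n) ∩ S = ∅ := by
      ext z
      simp only [mem_inter_iff, mem_iInter, hs, mem_setOf_eq, hS, mem_prod, mem_Ioo, mem_univ,
        and_true, mem_empty_iff_false, iff_false, not_and]
      intro hz hz0 hzT
      -- `ρ n → 0`, so some `ρ n < T - z.1`
      have hev := hρ0.eventually (gt_mem_nhds (sub_pos.2 hzT))
      obtain ⟨n, hn⟩ := hev.exists
      linarith [hz n]
    rw [hempty, Measure.restrict_empty, lintegral_zero_measure]
  rw [hzero] at hlim
  refine (tendsto_congr fun n => ?_).1 hlim
  exact hμs n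

/-! ## §2 Half of the concentration is carried by the integrable majorant -/

/-- **Majorant concentration at a singular point**: there are `ε > 0`, `r₂ > 0` (with `r₂² ≤ T`) such
that at every singular point `x₀` of the final slice and every `0 < r ≤ r₂`,
`∫∫_{Q_r(T,x₀)} H > ε³ r² / 2`, `H = |u|³ + 2|p̃[u]|^{3/2} + 2|Δ⁻¹∇·f|²` (CKN concentration, and
`|u|³ + |p_N|^{3/2} ≤ H + 2` pointwise, with `2|Q_r| = 2|B₁| r⁵ ≤ ε³r²/2` for small `r`). No named fact.
[cite: CaffarelliKohnNirenberg1982, Prop. 1] -/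
theorem majorant_concentration (hν : 0 < ν) :
    ∃ ε r₂ : ℝ, 0 < ε ∧ 0 < r₂ ∧ r₂ ^ 2 ≤ X.T ∧
      ∀ x₀ : EuclideanSpace ℝ (Fin 3), ¬ IsBackwardBoundedAt X.u X.T x₀ → ∀ r : ℝ, 0 < r → r ≤ r₂ →
        ENNReal.ofReal (ε ^ 3 * r ^ 2 / 2) <
          ∫⁻ z in parabolicCylinder r ((X.T : ℝ), x₀),
            (‖X.u z.1 z.2‖ₑ ^ (3 : ℕ) + 2 * ‖normalisedPressure (X.u z.1) z.2‖ₑ ^ (3 / 2 : ℝ) +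
              2 * (1 : ℝ≥0∞)⁻¹ ^ (1 / 2 : ℝ) * ‖forcePotential (X.f z.1) z.2‖ₑ ^ 2) := by
  have hT := X.T_pos
  obtain ⟨ε, r₁, hε, hr₁, hconc⟩ := X.ckn_concentration hν
  set V₁e : ℝ≥0∞ := volume (ball (0 : EuclideanSpace ℝ (Fin 3)) 1) with hV₁e
  have hV₁top : V₁e ≠ ⊤ := measure_ball_lt_top.ne
  set V₁ : ℝ := V₁e.toReal with hV₁
  have hV₁0 : 0 ≤ V₁ := ENNReal.toReal_nonneg
  have hV₁eq : V₁e = ENNReal.ofReal V₁ := (ENNReal.ofReal_toReal hV₁top).symm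
  set r₂ : ℝ := min (min r₁ (Real.sqrt X.T)) (min 1 (ε ^ 3 / (4 * V₁ + 4))) with hr₂
  have hr₂pos : 0 < r₂ := lt_min (lt_min hr₁ (Real.sqrt_pos.2 hT))
    (lt_min one_pos (div_pos (pow_pos hε 3) (by positivity)))
  have hr₂T : r₂ ^ 2 ≤ X.T := by
    calc r₂ ^ 2 ≤ Real.sqrt X.T ^ 2 :=
        pow_le_pow_left₀ hr₂pos.le ((min_le_left _ _).trans (min_le_right _ _)) 2
      _ = X.T := Real.sq_sqrt hT.le
  refine ⟨ε, r₂, hε, hr₂pos, hr₂T, fun x₀ hx₀ r hr hrr₂ => ?_⟩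
  have hrr₁ : r ≤ r₁ := hrr₂.trans ((min_le_left _ _).trans (min_le_left _ _))
  have hr1 : r ≤ 1 := hrr₂.trans ((min_le_right _ _).trans (min_le_left _ _))
  have hrε : r ≤ ε ^ 3 / (4 * V₁ + 4) := hrr₂.trans ((min_le_right _ _).trans (min_le_right _ _))
  have hlt := hconc x₀ hx₀ r hr hrr₁
  -- pointwise `|u|³ + |p_N|^{3/2} ≤ H + 2`
  have hpt : ∀ z : ℝ × EuclideanSpace ℝ (Fin 3),
      ‖X.u z.1 z.2‖ₑ ^ (3 : ℕ) +
          ‖normalisedPressure (X.u z.1) z.2 + forcePotential (X.f z.1) z.2‖ₑ ^ (3 / 2 : ℝ) ≤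
        (‖X.u z.1 z.2‖ₑ ^ (3 : ℕ) + 2 * ‖normalisedPressure (X.u z.1) z.2‖ₑ ^ (3 / 2 : ℝ) +
            2 * (1 : ℝ≥0∞)⁻¹ ^ (1 / 2 : ℝ) * ‖forcePotential (X.f z.1) z.2‖ₑ ^ 2) +
          2 * (1 : ℝ≥0∞) ^ (3 / 2 : ℝ) := by
    intro z
    have h1 := enorm_add_rpow_threeHalves_le (normalisedPressure (X.u z.1) z.2)
      (forcePotential (X.f z.1) z.2)
    have h2 := rpow_threeHalves_le_add ‖forcePotential (X.f z.1) z.2‖ₑ ENNReal.one_ne_top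
    calc ‖X.u z.1 z.2‖ₑ ^ (3 : ℕ) +
          ‖normalisedPressure (X.u z.1) z.2 + forcePotential (X.f z.1) z.2‖ₑ ^ (3 / 2 : ℝ)
        ≤ ‖X.u z.1 z.2‖ₑ ^ (3 : ℕ) + 2 * (‖normalisedPressure (X.u z.1) z.2‖ₑ ^ (3 / 2 : ℝ) +
            ((1 : ℝ≥0∞) ^ (3 / 2 : ℝ) +
              (1 : ℝ≥0∞)⁻¹ ^ (1 / 2 : ℝ) * ‖forcePotential (X.f z.1) z.2‖ₑ ^ 2)) := by
          gcongr
          exact h1.trans (by gcongr)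
      _ = _ := by ring
  -- the volume of the cylinder
  have hvol : volume (parabolicCylinder r ((X.T : ℝ), x₀)) =
      ENNReal.ofReal (r ^ 2) * (ENNReal.ofReal (r ^ 3) * V₁e) := by
    rw [parabolicCylinder, Measure.volume_eq_prod, Measure.prod_prod, Real.volume_Ioo,
      Measure.addHaar_ball_of_pos _ _ hr, finrank_euclideanSpace_fin]
    congr 2
    ring
  have hconst : (2 * (1 : ℝ≥0∞) ^ (3 / 2 : ℝ)) * volume (parabolicCylinder r ((X.T : ℝ), x₀)) =
      ENNReal.ofReal (2 * V₁ * r ^ 5) := by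
    rw [ENNReal.one_rpow, mul_one, hvol, hV₁eq]
    have e1 : ENNReal.ofReal (r ^ 2) * (ENNReal.ofReal (r ^ 3) * ENNReal.ofReal V₁) =
        ENNReal.ofReal (r ^ 2 * (r ^ 3 * V₁)) := by
      rw [← ENNReal.ofReal_mul (pow_pos hr 3).le, ← ENNReal.ofReal_mul (pow_pos hr 2).le]
    rw [e1, show (2 : ℝ≥0∞) = ENNReal.ofReal 2 by norm_num,
      ← ENNReal.ofReal_mul (by norm_num : (0 : ℝ) ≤ 2)]
    congr 1
    ring
  -- the real inequality `ε³r²/2 + 2 V₁ r⁵ ≤ ε³ r²`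
  have hreal : ε ^ 3 * r ^ 2 / 2 + 2 * V₁ * r ^ 5 ≤ ε ^ 3 * r ^ 2 := by
    have h4 : 0 < 4 * V₁ + 4 := by positivity
    have h1 : r * (4 * V₁ + 4) ≤ ε ^ 3 := (le_div_iff₀ h4).1 hrε
    have h5 : r ^ 5 ≤ r ^ 3 := pow_le_pow_of_le_one hr.le hr1 (by norm_num)
    nlinarith [pow_pos hr 2, pow_pos hr 3, mul_nonneg hV₁0 (pow_pos hr 3).le]
  by_contra hle
  rw [not_lt] at hle
  have hbound : ∫⁻ z in parabolicCylinder r ((X.T : ℝ), x₀),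
      (‖X.u z.1 z.2‖ₑ ^ (3 : ℕ) +
        ‖normalisedPressure (X.u z.1) z.2 + forcePotential (X.f z.1) z.2‖ₑ ^ (3 / 2 : ℝ)) ≤
        ENNReal.ofReal (ε ^ 3 * r ^ 2) := by
    calc _ ≤ ∫⁻ z in parabolicCylinder r ((X.T : ℝ), x₀),
          ((‖X.u z.1 z.2‖ₑ ^ (3 : ℕ) + 2 * ‖normalisedPressure (X.u z.1) z.2‖ₑ ^ (3 / 2 : ℝ) +
            2 * (1 : ℝ≥0∞)⁻¹ ^ (1 / 2 : ℝ) * ‖forcePotential (X.f z.1) z.2‖ₑ ^ 2) +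
            2 * (1 : ℝ≥0∞) ^ (3 / 2 : ℝ)) := lintegral_mono fun z => hpt z
      _ = (∫⁻ z in parabolicCylinder r ((X.T : ℝ), x₀),
          (‖X.u z.1 z.2‖ₑ ^ (3 : ℕ) + 2 * ‖normalisedPressure (X.u z.1) z.2‖ₑ ^ (3 / 2 : ℝ) +
            2 * (1 : ℝ≥0∞)⁻¹ ^ (1 / 2 : ℝ) * ‖forcePotential (X.f z.1) z.2‖ₑ ^ 2)) +
            ENNReal.ofReal (2 * V₁ * r ^ 5) := by
          rw [lintegral_add_right _ measurable_const, setLIntegral_const, hconst]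
      _ ≤ ENNReal.ofReal (ε ^ 3 * r ^ 2 / 2) + ENNReal.ofReal (2 * V₁ * r ^ 5) :=
          add_le_add hle le_rfl
      _ = ENNReal.ofReal (ε ^ 3 * r ^ 2 / 2 + 2 * V₁ * r ^ 5) :=
          (ENNReal.ofReal_add (by positivity) (by positivity)).symm
      _ ≤ ENNReal.ofReal (ε ^ 3 * r ^ 2) := ENNReal.ofReal_le_ofReal hreal
  exact absurd (hlt.trans_le hbound) (lt_irrefl _)

/-! ## §3 The packing bound -/

/-- Backward cylinders of radius `r` at `2r`-separated centres are disjoint. [folklore] -/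
theorem pairwiseDisjoint_parabolicCylinder_of_separated {T r : ℝ}
    {P : Finset (EuclideanSpace ℝ (Fin 3))}
    (hsep : (P : Set (EuclideanSpace ℝ (Fin 3))).Pairwise fun x y => 2 * r ≤ dist x y) :
    (P : Set (EuclideanSpace ℝ (Fin 3))).PairwiseDisjoint
      fun x => parabolicCylinder r ((T : ℝ), x) := by
  intro x hx y hy hxy
  refine disjoint_left.2 fun z hzx hzy => ?_
  rw [mem_parabolicCylinder] at hzx hzy
  have h := hsep hx hy hxy
  have := dist_triangle_left x y z.2
  simp only at hzx hzy
  linarith [hzx.2, hzy.2, dist_comm z.2 x, dist_comm z.2 y]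

/-- **PACKING BOUND FOR THE SINGULAR SLICE.** With `ε, r₂` of `majorant_concentration`: for every
`0 < r ≤ r₂` and every finite `2r`-separated set `P` of singular points of the final slice,
`#P · ε³r²/2 ≤ m(r) := ∫∫_{((0,T)×ℝ³) ∩ {t > T - r²}} H` — the cylinders `Q_r(T, x)`, `x ∈ P`, are
disjoint and each carries `ε³r²/2`. Since `m(r) → 0` (`tendsto_stripMass`), `#P = o(r⁻²)`: the
singular slice has no two-dimensional part (Scheffer; CKN 1982 §6 at the top slice). No named fact.
[cite: CaffarelliKohnNirenberg1982, §6] -/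
theorem card_separated_singular_le (hν : 0 < ν) :
    ∃ ε r₂ : ℝ, 0 < ε ∧ 0 < r₂ ∧ ∀ r : ℝ, 0 < r → r ≤ r₂ →
      ∀ P : Finset (EuclideanSpace ℝ (Fin 3)),
        (∀ x ∈ P, ¬ IsBackwardBoundedAt X.u X.T x) →
        (P : Set (EuclideanSpace ℝ (Fin 3))).Pairwise (fun x y => 2 * r ≤ dist x y) →
          (P.card : ℝ≥0∞) * ENNReal.ofReal (ε ^ 3 * r ^ 2 / 2) ≤
            ∫⁻ z in (Ioo 0 X.T ×ˢ (univ : Set (EuclideanSpace ℝ (Fin 3)))) ∩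
                {z : ℝ × EuclideanSpace ℝ (Fin 3) | X.T - r ^ 2 < z.1},
              (‖X.u z.1 z.2‖ₑ ^ (3 : ℕ) + 2 * ‖normalisedPressure (X.u z.1) z.2‖ₑ ^ (3 / 2 : ℝ) +
                2 * (1 : ℝ≥0∞)⁻¹ ^ (1 / 2 : ℝ) * ‖forcePotential (X.f z.1) z.2‖ₑ ^ 2) := by
  obtain ⟨ε, r₂, hε, hr₂, hr₂T, hconc⟩ := X.majorant_concentration hν
  refine ⟨ε, r₂, hε, hr₂, fun r hr hrr₂ P hP hsep => ?_⟩
  have hrT : r ^ 2 ≤ X.T := (pow_le_pow_left₀ hr.le hrr₂ 2).trans hr₂T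
  -- each cylinder carries `ε³ r² / 2`
  have h1 : (P.card : ℝ≥0∞) * ENNReal.ofReal (ε ^ 3 * r ^ 2 / 2) ≤
      ∑ x ∈ P, ∫⁻ z in parabolicCylinder r ((X.T : ℝ), x),
        (‖X.u z.1 z.2‖ₑ ^ (3 : ℕ) + 2 * ‖normalisedPressure (X.u z.1) z.2‖ₑ ^ (3 / 2 : ℝ) +
          2 * (1 : ℝ≥0∞)⁻¹ ^ (1 / 2 : ℝ) * ‖forcePotential (X.f z.1) z.2‖ₑ ^ 2) := by
    rw [← nsmul_eq_mul, ← Finset.sum_const]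
    exact Finset.sum_le_sum fun x hx => (hconc x (hP x hx) r hr hrr₂).le
  -- the cylinders are disjoint and lie in the strip
  have h2 := (lintegral_biUnion_finset (μ := (volume : Measure (ℝ × EuclideanSpace ℝ (Fin 3))))
    (pairwiseDisjoint_parabolicCylinder_of_separated (T := X.T) hsep)
    (fun x _ => (isOpen_parabolicCylinder r ((X.T : ℝ), x)).measurableSet)
    (fun z => ‖X.u z.1 z.2‖ₑ ^ (3 : ℕ) + 2 * ‖normalisedPressure (X.u z.1) z.2‖ₑ ^ (3 / 2 : ℝ) +
      2 * (1 : ℝ≥0∞)⁻¹ ^ (1 / 2 : ℝ) * ‖forcePotential (X.f z.1) z.2‖ₑ ^ 2)).symm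
  have hsub : (⋃ x ∈ P, parabolicCylinder r ((X.T : ℝ), x)) ⊆
      (Ioo 0 X.T ×ˢ (univ : Set (EuclideanSpace ℝ (Fin 3)))) ∩
        {z : ℝ × EuclideanSpace ℝ (Fin 3) | X.T - r ^ 2 < z.1} := by
    intro z hz
    obtain ⟨x, -, hzx⟩ := mem_iUnion₂.1 hz
    rw [mem_parabolicCylinder] at hzx
    exact ⟨⟨⟨by nlinarith [hzx.1.1], hzx.1.2⟩, mem_univ _⟩, hzx.1.1⟩
  exact h1.trans (h2.le.trans (lintegral_mono_set hsub))

/-! ## §4 Finite `2r`-nets of the singular slice -/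

/-- **A FINITE `2r`-NET OF THE SINGULAR SLICE WITH THE PACKING BOUND.** With `ε, r₂` as above: for
every `0 < r ≤ r₂` there is a finite `2r`-separated set `P` of singular points of the final slice such
that EVERY singular point lies in `⋃_{x ∈ P} B̄(x, 2r)`, and `#P · ε³r²/2 ≤ m(r)` (a separated subset
of maximal cardinality, which exists by the packing bound; maximality gives the covering). No named
fact. [cite: CaffarelliKohnNirenberg1982, §6] [cite: RobinsonRodrigoSadowski2016, Thm. 16.2] -/
theorem exists_finite_net_singularSlice (hν : 0 < ν) :
    ∃ ε r₂ : ℝ, 0 < ε ∧ 0 < r₂ ∧ ∀ r : ℝ, 0 < r → r ≤ r₂ →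
      ∃ P : Finset (EuclideanSpace ℝ (Fin 3)),
        (∀ x ∈ P, ¬ IsBackwardBoundedAt X.u X.T x) ∧
        {x₀ : EuclideanSpace ℝ (Fin 3) | ¬ IsBackwardBoundedAt X.u X.T x₀} ⊆
            ⋃ x ∈ P, closedBall x (2 * r) ∧
          (P.card : ℝ≥0∞) * ENNReal.ofReal (ε ^ 3 * r ^ 2 / 2) ≤
            ∫⁻ z in (Ioo 0 X.T ×ˢ (univ : Set (EuclideanSpace ℝ (Fin 3)))) ∩
                {z : ℝ × EuclideanSpace ℝ (Fin 3) | X.T - r ^ 2 < z.1},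
              (‖X.u z.1 z.2‖ₑ ^ (3 : ℕ) + 2 * ‖normalisedPressure (X.u z.1) z.2‖ₑ ^ (3 / 2 : ℝ) +
                2 * (1 : ℝ≥0∞)⁻¹ ^ (1 / 2 : ℝ) * ‖forcePotential (X.f z.1) z.2‖ₑ ^ 2) := by
  obtain ⟨ε, r₂, hε, hr₂, hpack⟩ := X.card_separated_singular_le hν
  have hmass : ∀ r : ℝ, 0 < r → r ≤ r₂ →
      ∫⁻ z in (Ioo 0 X.T ×ˢ (univ : Set (EuclideanSpace ℝ (Fin 3)))) ∩
          {z : ℝ × EuclideanSpace ℝ (Fin 3) | X.T - r ^ 2 < z.1},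
        (‖X.u z.1 z.2‖ₑ ^ (3 : ℕ) + 2 * ‖normalisedPressure (X.u z.1) z.2‖ₑ ^ (3 / 2 : ℝ) +
          2 * (1 : ℝ≥0∞)⁻¹ ^ (1 / 2 : ℝ) * ‖forcePotential (X.f z.1) z.2‖ₑ ^ 2) < ⊤ :=
    fun r _ _ => (lintegral_mono_set inter_subset_left).trans_lt
      (X.lintegral_slab_majorant_lt_top hν one_ne_zero)
  refine ⟨ε, r₂, hε, hr₂, fun r hr hrr₂ => ?_⟩
  classical
  set m : ℝ≥0∞ := ∫⁻ z in (Ioo 0 X.T ×ˢ (univ : Set (EuclideanSpace ℝ (Fin 3)))) ∩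
      {z : ℝ × EuclideanSpace ℝ (Fin 3) | X.T - r ^ 2 < z.1},
    (‖X.u z.1 z.2‖ₑ ^ (3 : ℕ) + 2 * ‖normalisedPressure (X.u z.1) z.2‖ₑ ^ (3 / 2 : ℝ) +
      2 * (1 : ℝ≥0∞)⁻¹ ^ (1 / 2 : ℝ) * ‖forcePotential (X.f z.1) z.2‖ₑ ^ 2) with hm
  have hmt : m ≠ ⊤ := (hmass r hr hrr₂).ne
  set c : ℝ≥0∞ := ENNReal.ofReal (ε ^ 3 * r ^ 2 / 2) with hc
  have hc0 : c ≠ 0 := (ENNReal.ofReal_pos.2 (by positivity)).ne'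
  have hct : c ≠ ⊤ := ENNReal.ofReal_ne_top
  -- admissible cardinalities
  set A : Set ℕ := {n | ∃ P : Finset (EuclideanSpace ℝ (Fin 3)), P.card = n ∧
    (∀ x ∈ P, ¬ IsBackwardBoundedAt X.u X.T x) ∧
    (P : Set (EuclideanSpace ℝ (Fin 3))).Pairwise (fun x y => 2 * r ≤ dist x y)} with hA
  have hA0 : (0 : ℕ) ∈ A := ⟨∅, Finset.card_empty, by simp, by simp⟩
  -- the bound: `n ≤ ⌈(m / c).toReal⌉₊`
  set N : ℕ := ⌈(m / c).toReal⌉₊ with hN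
  have hAbdd : BddAbove A := by
    refine ⟨N, fun n hn => ?_⟩
    obtain ⟨P, hPn, hP, hsep⟩ := hn
    have h := hpack r hr hrr₂ P hP hsep
    rw [hPn] at h
    have h' : (n : ℝ≥0∞) ≤ m / c := by
      rw [ENNReal.le_div_iff_mul_le (Or.inl hc0) (Or.inl hct)]
      exact h
    have h'' : (n : ℝ) ≤ (m / c).toReal := by
      have := ENNReal.toReal_mono (ENNReal.div_ne_top hmt hc0) h'
      simpa using this
    exact Nat.cast_le.1 (h''.trans (Nat.le_ceil _))
  -- a separated set of singular points of maximal cardinality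
  obtain ⟨P, hPcard, hP, hsep⟩ := Nat.sSup_mem ⟨0, hA0⟩ hAbdd
  refine ⟨P, hP, fun y hy => ?_, hpack r hr hrr₂ P hP hsep⟩
  -- maximality: `y` is within `2r` of `P`
  by_contra hfar
  have hfar' : ∀ x ∈ P, 2 * r < dist x y := by
    intro x hx
    by_contra hle
    exact hfar (mem_iUnion₂.2 ⟨x, hx, mem_closedBall.2 (by rw [dist_comm]; exact not_lt.1 hle)⟩)
  have hyP : y ∉ P := by
    intro hyP
    have := hfar' y hyP
    rw [dist_self] at this
    linarith
  have hins : (insert y P).card ∈ A := by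
    refine ⟨insert y P, rfl, ?_, ?_⟩
    · intro x hx
      rcases Finset.mem_insert.1 hx with rfl | hx
      · exact hy
      · exact hP x hx
    · rw [Finset.coe_insert]
      refine Set.Pairwise.insert hsep fun x hx _ => ⟨?_, ?_⟩
      · rw [dist_comm]; exact (hfar' x hx).le
      · exact (hfar' x hx).le
  have hle := le_csSup hAbdd hins
  rw [Finset.card_insert_of_notMem hyP, hPcard] at hle
  omega

end ClayBlowup

end Summit.NavierStokesRegularity.FluidComputer

end
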